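import Mathlib.Analysis.RCLike.Basic
import Mathlib.Topology.Homotopy.Equiv
import Mathlib.Topology.VectorBundle.Basic
import Literature.AlgebraicTopology.SingularHomology.CohomologyHomotopyInvariance
import HarnessLib

/-!
# The zero section of a vector bundle is a homotopy equivalence; `p^* : H^i(B) ≅ H^i(E)`

Topic `Literature/AlgebraicTopology/CharacteristicClasses`. For a topological vector bundle
`p : E → B` (Mathlib's `VectorBundle 𝕜 F E`, total space `Bundle.TotalSpace F E`) over `𝕜 = ℝ`
or `ℂ` (`RCLike 𝕜`), the zero cross section `s : B → E` (Husemoller, *Fibre Bundles*, Ch. 3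
Prop. 1.6: "the map `b ↦ 0 ∈ p⁻¹(b)` is a cross section (the zero cross section)") is a homotopy
inverse of the projection: `p ∘ s = 1_B` on the nose and `s ∘ p ≃ 1_E` through the fibrewise
linear homotopy `h_t(v) = t·v`. Consequently (Husemoller, Ch. 17 §7, before Def. 7.4: "The
morphism `p^* : H^i(B) → H^i(E)` is an isomorphism" — the input of the definition of the Euler
class `e(ξ) = p^{*-1} j^*(U_ξ)`, Def. 7.4, and of the Gysin sequence, Thm. 7.5) the projection
induces isomorphisms on the tree's singular cohomology
(`Literature.AlgebraicTopology.SingularHomology.singularCohomology`), by the tree's homotopy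
invariance (`singularCohomology.isoOfHomotopyEquiv'`, `CohomologyHomotopyInvariance.lean`).

## Contents (everything proved; no named facts)

* `continuous_totalSpace_smul` — joint continuity of the fibrewise scalar action
  `(c, v) ↦ c • v` on the total space of a vector bundle (read in a local trivialisation, where it
  is `(c, (b, y)) ↦ (b, c • y)` by linearity of the trivialisation);
* `bundleProjMap`, `zeroSectionMap` — `p` and `s` as bundled continuous maps,
  `bundleProjMap_comp_zeroSectionMap : p ∘ s = 𝟙`;
* `zeroSectionHomotopy` — the homotopy `s ∘ p ≃ 𝟙_E`, `(t, v) ↦ t • v`;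
* `zeroSectionHomotopyEquiv : TotalSpace F E ≃ₕ B`;
* `projCohomologyIso` — `p^* : Hⁿ(B; M) ≅ Hⁿ(E; M)` with `hom = p^*` and
  `inv = s^*`, and the equational forms `map_zeroSectionMap_comp_map_bundleProjMap`,
  `map_bundleProjMap_comp_map_zeroSectionMap`, `map_bundleProjMap_bijective`.

## Design notes

* Scalars: the homotopy uses the real segment `t ↦ (t : 𝕜)`, so `𝕜` is `RCLike` (`ℝ`, `ℂ`); the
  continuity lemma is stated for any nontrivially normed field.
* Universes: the cohomology statements need `B` and the fibres in the same universe (the tree's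
  `singularCohomology.map` relates spaces of one universe); the homotopy statements are fully
  universe-polymorphic.
* Mathlib has `Bundle.zeroSection`, `Trivialization.continuous_zeroSection`, `Trivialization.continuousAt_of_comp_left`
  (used); no homotopy equivalence `E ≃ₕ B` and no cohomology of total spaces (searched
  `zeroSection`, `HomotopyEquiv` + `TotalSpace`). Nothing restated.

## References

* [HusemollerFibreBundles1994] D. Husemoller, *Fibre Bundles*, 3rd ed., GTM 20 (1994), Ch. 3
  Prop. 1.6 (zero cross section); Ch. 17 §7 (Thm. 7.3 ff., "`p^*` is an isomorphism", Def. 7.4).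
* [HatcherAT2002] A. Hatcher, *Algebraic Topology* (2002), §3.1 p. 201 (homotopy invariance of
  cohomology), Cor. 2.11.
-/

noncomputable section

open Bundle Topology unitInterval

universe u v w w'

namespace Literature.AlgebraicTopology.CharacteristicClasses

/-! ### Continuity of the fibrewise scalar action on the total space -/

section SMul

variable {𝕜 : Type w} [NontriviallyNormedField 𝕜] {B : Type u} [TopologicalSpace B]
  {F : Type v} [NormedAddCommGroup F] [NormedSpace 𝕜 F] {E : B → Type w'}
  [∀ x, AddCommMonoid (E x)] [∀ x, Module 𝕜 (E x)] [TopologicalSpace (TotalSpace F E)]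
  [∀ x, TopologicalSpace (E x)] [FiberBundle F E] [VectorBundle 𝕜 F E]

variable (𝕜 F E) in
/-- **The fibrewise scalar action `(c, v) ↦ c • v` is jointly continuous on the total space of a
vector bundle** (in a local trivialisation `h : U × F^k → p⁻¹(U)` it reads
`(c, (b, y)) ↦ (b, c • y)`, as in Husemoller's proof that `φ s` is a cross section, Ch. 3
Prop. 1.6). [cite: HusemollerFibreBundles1994, Ch. 3 Prop. 1.6 (proof)] -/
theorem continuous_totalSpace_smul :
    Continuous fun q : 𝕜 × TotalSpace F E ↦ (⟨q.2.proj, q.1 • q.2.2⟩ : TotalSpace F E) := by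
  refine continuous_iff_continuousAt.2 fun q₀ ↦ ?_
  set e := trivializationAt F E q₀.2.proj with he
  have hq₀ : q₀.2.proj ∈ e.baseSet := mem_baseSet_trivializationAt F E q₀.2.proj
  refine e.continuousAt_of_comp_left ?_ hq₀ ?_
  · exact ((FiberBundle.continuous_proj F E).comp continuous_snd).continuousAt
  · -- near `q₀` the composite with the trivialisation is `q ↦ (q.2.proj, q.1 • (e q.2).2)`
    have hsrc : ∀ᶠ q : 𝕜 × TotalSpace F E in 𝓝 q₀, q.2 ∈ e.source :=
      continuousAt_snd.preimage_mem_nhds (e.open_source.mem_nhds (by rwa [e.mem_source]))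
    have key : (e ∘ fun q : 𝕜 × TotalSpace F E ↦ (⟨q.2.proj, q.1 • q.2.2⟩ : TotalSpace F E)) =ᶠ[𝓝 q₀]
        fun q ↦ (q.2.proj, q.1 • (e q.2).2) := by
      filter_upwards [hsrc] with q hq
      change e ⟨q.2.proj, q.1 • q.2.2⟩ = (q.2.proj, q.1 • (e q.2).2)
      rw [e.apply_eq_prod_continuousLinearEquivAt 𝕜 q.2.proj (e.mem_source.1 hq), map_smul,
        e.continuousLinearEquivAt_apply' q.2 hq]
    refine (continuousAt_congr key).2 ?_
    have h2 : ContinuousAt (fun q : 𝕜 × TotalSpace F E ↦ e q.2) q₀ :=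
      (e.continuousOn.continuousAt (e.open_source.mem_nhds (by rwa [e.mem_source]))).comp
        continuousAt_snd
    exact (((FiberBundle.continuous_proj F E).comp continuous_snd).continuousAt).prodMk
      (continuousAt_fst.smul h2.snd)

end SMul

/-! ### The zero section as a homotopy inverse of the projection -/

section Homotopy

variable (𝕜 : Type w) [RCLike 𝕜] {B : Type u} [TopologicalSpace B]
  (F : Type v) [NormedAddCommGroup F] [NormedSpace 𝕜 F] (E : B → Type w')
  [∀ x, AddCommMonoid (E x)] [∀ x, Module 𝕜 (E x)] [TopologicalSpace (TotalSpace F E)]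
  [∀ x, TopologicalSpace (E x)] [FiberBundle F E] [VectorBundle 𝕜 F E]

/-- The projection `p : E → B` of a vector bundle as a bundled continuous map. [folklore] -/
abbrev bundleProjMap : C(TotalSpace F E, B) := ⟨TotalSpace.proj, FiberBundle.continuous_proj F E⟩

/-- The zero cross section `s : B → E`, `b ↦ 0 ∈ p⁻¹(b)`, as a bundled continuous map
(Husemoller, Ch. 3 Prop. 1.6; continuity is Mathlib's `Trivialization.continuous_zeroSection`).
[cite: HusemollerFibreBundles1994, Ch. 3 Prop. 1.6] -/
abbrev zeroSectionMap : C(B, TotalSpace F E) :=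
  ⟨zeroSection F E, Trivialization.continuous_zeroSection 𝕜⟩

/-- `p ∘ s = 1_B`: the zero section is a section. [cite: HusemollerFibreBundles1994, Ch. 3 Prop. 1.6] -/
@[simp]
theorem bundleProjMap_comp_zeroSectionMap :
    (bundleProjMap F E).comp (zeroSectionMap 𝕜 F E) = ContinuousMap.id B := rfl

/-- **The linear homotopy `h_t(v) = t • v` from `s ∘ p` (`t = 0`) to the identity of `E`
(`t = 1`)**: the zero section embeds `B` as a deformation retract of the total space
(the homotopy behind Husemoller Ch. 17 §7, "`p^* : H^i(B) → H^i(E)` is an isomorphism").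
[cite: HusemollerFibreBundles1994, Ch. 17 §7 (Thm. 7.3 ff.)] -/
def zeroSectionHomotopy :
    ContinuousMap.Homotopy ((zeroSectionMap 𝕜 F E).comp (bundleProjMap F E))
      (ContinuousMap.id (TotalSpace F E)) where
  toFun q := ⟨q.2.proj, ((q.1 : ℝ) : 𝕜) • q.2.2⟩
  continuous_toFun :=
    (continuous_totalSpace_smul 𝕜 F E).comp
      ((RCLike.continuous_ofReal.comp (continuous_induced_dom.comp continuous_fst)).prodMk
        continuous_snd)
  map_zero_left q := by
    change (⟨q.proj, ((0 : ℝ) : 𝕜) • q.2⟩ : TotalSpace F E) = ⟨q.proj, 0⟩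
    rw [RCLike.ofReal_zero, zero_smul]
  map_one_left q := by
    change (⟨q.proj, ((1 : ℝ) : 𝕜) • q.2⟩ : TotalSpace F E) = q
    rw [RCLike.ofReal_one, one_smul]

/-- At time `t` the homotopy multiplies the vector by `t`. [folklore] -/
@[simp]
theorem zeroSectionHomotopy_apply (t : I) (q : TotalSpace F E) :
    zeroSectionHomotopy 𝕜 F E (t, q) = ⟨q.proj, ((t : ℝ) : 𝕜) • q.2⟩ := rfl

/-- **The projection of a vector bundle is a homotopy equivalence `E ≃ₕ B` with homotopy inverse
the zero section** (`p ∘ s = 1`, `s ∘ p ≃ 1` by `zeroSectionHomotopy`).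
[cite: HusemollerFibreBundles1994, Ch. 17 §7 (Thm. 7.3 ff.)] -/
def zeroSectionHomotopyEquiv : ContinuousMap.HomotopyEquiv (TotalSpace F E) B where
  toFun := bundleProjMap F E
  invFun := zeroSectionMap 𝕜 F E
  left_inv := ⟨zeroSectionHomotopy 𝕜 F E⟩
  right_inv := by
    rw [bundleProjMap_comp_zeroSectionMap]

/-- The forward map of `zeroSectionHomotopyEquiv` is the projection. [folklore] -/
@[simp]
theorem zeroSectionHomotopyEquiv_toFun : (zeroSectionHomotopyEquiv 𝕜 F E).toFun = bundleProjMap F E := rfl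

/-- The homotopy inverse in `zeroSectionHomotopyEquiv` is the zero section. [folklore] -/
@[simp]
theorem zeroSectionHomotopyEquiv_invFun : (zeroSectionHomotopyEquiv 𝕜 F E).invFun = zeroSectionMap 𝕜 F E := rfl

/-- `s ∘ p` is homotopic to the identity of the total space. [cite: HusemollerFibreBundles1994, Ch. 17 §7 (Thm. 7.3 ff.)] -/
theorem zeroSectionMap_comp_bundleProjMap_homotopic :
    ((zeroSectionMap 𝕜 F E).comp (bundleProjMap F E)).Homotopic (ContinuousMap.id (TotalSpace F E)) :=
  ⟨zeroSectionHomotopy 𝕜 F E⟩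

end Homotopy

/-! ### `p^* : Hⁿ(B; M) ≅ Hⁿ(E; M)` -/

section Cohomology

open Literature.AlgebraicTopology.SingularHomology CategoryTheory

variable (𝕜 : Type w) [RCLike 𝕜] {B : Type u} [TopologicalSpace B]
  (F : Type v) [NormedAddCommGroup F] [NormedSpace 𝕜 F] (E : B → Type u)
  [∀ x, AddCommMonoid (E x)] [∀ x, Module 𝕜 (E x)] [TopologicalSpace (TotalSpace F E)]
  [∀ x, TopologicalSpace (E x)] [FiberBundle F E] [VectorBundle 𝕜 F E]
  (R : Type v) [CommRing R] (M : Type v) [AddCommGroup M] [Module R M]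

/-- **`p^* : Hⁿ(B; M) ≅ Hⁿ(E; M)` for the projection of a vector bundle** (Husemoller, Ch. 17 §7:
"The morphism `p^* : H^i(B) → H^i(E)` is an isomorphism"), with `hom = p^*` and `inv = s^*` for
the zero section `s`: the tree's `singularCohomology.isoOfHomotopyEquiv'` on `zeroSectionHomotopyEquiv`.
[cite: HusemollerFibreBundles1994, Ch. 17 §7 (Thm. 7.3 ff.)] -/
def projCohomologyIso (n : ℕ) :
    singularCohomology R M B n ≅ singularCohomology R M (TotalSpace F E) n :=
  singularCohomology.isoOfHomotopyEquiv' R M (zeroSectionHomotopyEquiv 𝕜 F E) n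

/-- The isomorphism IS `p^*`. [folklore] -/
@[simp]
theorem projCohomologyIso_hom (n : ℕ) :
    (projCohomologyIso 𝕜 F E R M n).hom = singularCohomology.map R M (bundleProjMap F E) n := rfl

/-- Its inverse is `s^*`, the pull-back along the zero section. [folklore] -/
@[simp]
theorem projCohomologyIso_inv (n : ℕ) :
    (projCohomologyIso 𝕜 F E R M n).inv =
      singularCohomology.map R M (zeroSectionMap 𝕜 F E) n := rfl

/-- `s^* ∘ p^* = 𝟙` on `Hⁿ(B; M)` (composition in `ModuleCat`: `p^* ≫ s^* = 𝟙`).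
[cite: HusemollerFibreBundles1994, Ch. 17 §7 (Thm. 7.3 ff.)] -/
@[simp]
theorem map_bundleProjMap_comp_map_zeroSectionMap (n : ℕ) :
    singularCohomology.map R M (bundleProjMap F E) n ≫ singularCohomology.map R M (zeroSectionMap 𝕜 F E) n =
      𝟙 _ :=
  (projCohomologyIso 𝕜 F E R M n).hom_inv_id

/-- `p^* ∘ s^* = 𝟙` on `Hⁿ(E; M)` (composition in `ModuleCat`: `s^* ≫ p^* = 𝟙`), i.e. every
class on the total space is pulled back from its restriction to the zero section.
[cite: HusemollerFibreBundles1994, Ch. 17 §7 (Thm. 7.3 ff.)] -/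
@[simp]
theorem map_zeroSectionMap_comp_map_bundleProjMap (n : ℕ) :
    singularCohomology.map R M (zeroSectionMap 𝕜 F E) n ≫ singularCohomology.map R M (bundleProjMap F E) n =
      𝟙 _ :=
  (projCohomologyIso 𝕜 F E R M n).inv_hom_id

include 𝕜 in
/-- `p^* : Hⁿ(B; M) → Hⁿ(E; M)` is bijective (for a `𝕜`-vector bundle, `𝕜 = ℝ` or `ℂ`).
[cite: HusemollerFibreBundles1994, Ch. 17 §7 (Thm. 7.3 ff.)] -/
theorem map_bundleProjMap_bijective (n : ℕ) :
    Function.Bijective (singularCohomology.map R M (bundleProjMap F E) n) :=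
  (projCohomologyIso 𝕜 F E R M n).toLinearEquiv.bijective

/-- `p^*(s^* x) = x` for every class `x` on the total space. [cite: HusemollerFibreBundles1994, Ch. 17 §7 (Thm. 7.3 ff.)] -/
@[simp]
theorem map_bundleProjMap_map_zeroSectionMap (n : ℕ) (x : singularCohomology R M (TotalSpace F E) n) :
    singularCohomology.map R M (bundleProjMap F E) n (singularCohomology.map R M (zeroSectionMap 𝕜 F E) n x) =
      x := by
  rw [← ModuleCat.comp_apply, map_zeroSectionMap_comp_map_bundleProjMap, ModuleCat.id_apply]

/-- `s^*(p^* y) = y` for every class `y` on the base. [cite: HusemollerFibreBundles1994, Ch. 17 §7 (Thm. 7.3 ff.)] -/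
@[simp]
theorem map_zeroSectionMap_map_bundleProjMap (n : ℕ) (y : singularCohomology R M B n) :
    singularCohomology.map R M (zeroSectionMap 𝕜 F E) n (singularCohomology.map R M (bundleProjMap F E) n y) =
      y := by
  rw [← ModuleCat.comp_apply, map_bundleProjMap_comp_map_zeroSectionMap, ModuleCat.id_apply]

end Cohomology

end Literature.AlgebraicTopology.CharacteristicClasses
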